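import Mathlib
import Summits.NavierStokesRegularity.OSWSelfSimilar.TypeIIModulatedWeights
import Summits.NavierStokesRegularity.OSWSelfSimilar.TypeIIInnerLimitUnitStream
import HarnessLib
/-!
# Type (β) requires SWIRL CONCENTRATION at the velocity scale (zone Z1 TEMPLATE §T1.4 (I-5)(i)/(C7) read on the
# PRE-LIMIT solution; kernel, unconditional)

HONEST FRAMING (cell ns-blowup GROUP B «PROFILE SEARCH», zone Z1; D-0035/D-0074): part XXXI of the Z1 dictionary. Part XXIV
proved (I-5)(i) on the inner object: a type-(β) `W` carries swirl, `Γ_W(s, y) ≠ 0` somewhere (KNSS Thm 5.2). Because the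
swirl `Γ = r u_θ` has WEIGHT 0 under the axis-centred zoom (part V `swirl_smul_comp_axisAffine`: `Γ` of the zoom slice
at `y` IS the physical `Γ` at `cₖ + λₖy`), this reads back on the PRE-LIMIT solution as a necessary condition that needs no
conjecture:

* `swirl_zoom_slice_axis`, `tendsto_swirl_of_tendsto`, `swirl_innerLimit_tendsto` — along an axis-centred zoom converging
  to `W`, the physical swirl at the zoom points converges: `Γ(tₖ + λₖ²s, cₖ + λₖy) → Γ_W(s, y)`;
* `innerLimit_const_of_swirl_thinning` — **SWIRL THINNING ⇒ TYPE (α), UNCONDITIONALLY**: if the physical swirl tends to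
  `0` at every zoom point (`Γ(tₖ + λₖ²s, cₖ + λₖy) → 0` for all `s < 0`, `y` — the swirl does not penetrate to horizontal
  distance `O(λₖ) = O(‖u‖_∞⁻¹)` from the axis), then the axisymmetric inner object has no swirl and is slice-wise
  constant (KNSS Thm 5.2 via part XXIV) — no Liouville CONJECTURE enters;
* `innerLimit_swirlConcentration_or_const_of_singularity` — the census sentence with this rider: on K8's standing
  hypotheses verbatim, EITHER (α) `W ≡ c` (unit, `c₁ = 0`), OR (β) the zoom is AXIS-centred (`cₖ` on the axis), `W` is
  the (AX-L) counterexample with the (I-5) signature, AND THE SWIRL CONCENTRATES AT THE VELOCITY SCALE: for some `s < 0`,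
  `y`, `Γ(tₖ + λₖ²s, cₖ + λₖy) → Γ_W(s, y) ≠ 0` — i.e. `|u_θ| = |Γ|/r ≳ |Γ_W(s,y)|/(λₖ‖y_h‖)`, the azimuthal velocity is
  COMPARABLE TO `‖u‖_∞` at horizontal distance `O(λₖ)` from the axis (a checkable signature for any instrument run:
  TEMPLATE (C7)'s inner-zone swirl profile must NOT flatten to zero at the core scale).

**Nothing here asserts that a singular solution exists or that (AX-L) holds or fails.** «violates: n/a — dictionary»;
bears_on LADDER-NS N5/Z1 → N1 linear core / N0⁻ ((I-5)(i), (C7)). Author: ns-blowup-profile-eng-1 g8, 2026-08-27.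
-/

open Real Filter Topology Set MeasureTheory Function Bornology
open scoped ENNReal NNReal
open Literature.Analysis.FluidPDE

namespace Summit.NavierStokesRegularity.OSWSelfSimilar
namespace TypeIIModulationDictionary

section SwirlConcentration

variable {T Mₛ : ℝ} {u : ℝ → EuclideanSpace ℝ (Fin 3) → EuclideanSpace ℝ (Fin 3)}
  {p : ℝ → EuclideanSpace ℝ (Fin 3) → ℝ} {W : ℝ → EuclideanSpace ℝ (Fin 3) → EuclideanSpace ℝ (Fin 3)}

/-- **The swirl has weight 0 under the axis-centred zoom**: for a centre `c` ON the axis,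
`Γ((λ•stPull λ² λ t₀ c u) s)(y) = Γ(u(t₀ + λ²s))(c + λy)` — the swirl of the zoom slice at `y` IS the physical swirl at the
zoom point (part V `swirl_smul_comp_axisAffine`; TEMPLATE (E5)/(I-2) `G⁽ⁿ⁾(y, s) = Γ(x, t)`). [new here — dictionary] -/
theorem swirl_zoom_slice_axis {c : EuclideanSpace ℝ (Fin 3)} (hc0 : c 0 = 0) (hc1 : c 1 = 0) (lam t₀ s : ℝ)
    (y : EuclideanSpace ℝ (Fin 3)) :
    swirl ((lam • stPull (lam ^ 2) lam t₀ c u) s) y = swirl (u (t₀ + lam ^ 2 * s)) (c + lam • y) := by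
  have h : (lam • stPull (lam ^ 2) lam t₀ c u) s = fun w => lam • u (t₀ + lam ^ 2 * s) (c + lam • w) := by
    funext w; simp [stPull_apply]
  rw [h]
  exact swirl_smul_comp_axisAffine _ hc0 hc1 lam y

/-- The swirl is continuous in the field value: pointwise convergence of fields at `y` gives convergence of their swirls
at `y`. [new here — elementary] -/
theorem tendsto_swirl_of_tendsto {V : ℕ → EuclideanSpace ℝ (Fin 3) → EuclideanSpace ℝ (Fin 3)}
    {V₀ : EuclideanSpace ℝ (Fin 3) → EuclideanSpace ℝ (Fin 3)} {y : EuclideanSpace ℝ (Fin 3)}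
    (h : Tendsto (fun n => V n y) atTop (𝓝 (V₀ y))) :
    Tendsto (fun n => swirl (V n) y) atTop (𝓝 (swirl V₀ y)) := by
  have hc : Continuous fun v : EuclideanSpace ℝ (Fin 3) => y 0 * v 1 - y 1 * v 0 :=
    (continuous_const.mul (PiLp.continuous_apply 2 (fun _ : Fin 3 => ℝ) 1)).sub
      (continuous_const.mul (PiLp.continuous_apply 2 (fun _ : Fin 3 => ℝ) 0))
  have h2 := (hc.tendsto _).comp h
  simp only [Function.comp_def] at h2
  simpa [swirl] using h2

/-- **The physical swirl at the zoom points converges to the swirl of the inner object**: along an AXIS-centred zoom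
(`cₖ` on the axis) converging slice-wise locally uniformly to `W` along `φ`,
`Γ(t_{φk} + λ_{φk}²s, c_{φk} + λ_{φk}y) → Γ_W(s, y)` for every `s < 0`, `y`. [new here — dictionary] -/
theorem swirl_innerLimit_tendsto {tn lamn : ℕ → ℝ} {cn : ℕ → EuclideanSpace ℝ (Fin 3)}
    (hc : ∀ k, cn k 0 = 0 ∧ cn k 1 = 0) {φ : ℕ → ℕ}
    (hconv : ∀ s < 0, TendstoLocallyUniformly
      (fun k => (lamn (φ k) • stPull (lamn (φ k) ^ 2) (lamn (φ k)) (tn (φ k)) (cn (φ k)) u) s) (W s) atTop) :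
    ∀ s < 0, ∀ y : EuclideanSpace ℝ (Fin 3),
      Tendsto (fun k => swirl (u (tn (φ k) + lamn (φ k) ^ 2 * s)) (cn (φ k) + lamn (φ k) • y)) atTop
        (𝓝 (swirl (W s) y)) := by
  intro s hs y
  have hpt := ((hconv s hs).tendstoLocallyUniformlyOn (s := univ)).tendsto_at (mem_univ y)
  have h := tendsto_swirl_of_tendsto hpt
  refine h.congr fun k => ?_
  exact swirl_zoom_slice_axis (hc (φ k)).1 (hc (φ k)).2 _ _ _ _

/-- **SWIRL THINNING AT THE VELOCITY SCALE ⇒ TYPE (α) — UNCONDITIONAL.** Let `W` be a KNSS blow-up limit with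
axisymmetric slices, obtained as the slice-wise locally uniform limit of an AXIS-centred gauge N-a zoom along `φ`. If the
physical swirl tends to zero at every zoom point — `Γ(t_{φk} + λ_{φk}²s, c_{φk} + λ_{φk}y) → 0` for all `s < 0`, `y` (the
swirl does not penetrate to horizontal distance `O(λₖ)` from the axis) — then `W` is slice-wise constant: part XXIV's
(I-5)(i) `typeBeta_exists_swirl_ne_zero` (KNSS Thm 5.2) contrapositively. NO Liouville conjecture is used. [new here —
dictionary; unconditional] -/
theorem innerLimit_const_of_swirl_thinning (hW : IsKNSSBlowupLimit W) (hax : ∀ s < 0, IsAxisymmetric (W s))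
    {tn lamn : ℕ → ℝ} {cn : ℕ → EuclideanSpace ℝ (Fin 3)} (hc : ∀ k, cn k 0 = 0 ∧ cn k 1 = 0) {φ : ℕ → ℕ}
    (hconv : ∀ s < 0, TendstoLocallyUniformly
      (fun k => (lamn (φ k) • stPull (lamn (φ k) ^ 2) (lamn (φ k)) (tn (φ k)) (cn (φ k)) u) s) (W s) atTop)
    (hthin : ∀ s < 0, ∀ y : EuclideanSpace ℝ (Fin 3),
      Tendsto (fun k => swirl (u (tn (φ k) + lamn (φ k) ^ 2 * s)) (cn (φ k) + lamn (φ k) • y)) atTop (𝓝 0)) :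
    ∀ s < 0, ∀ y : EuclideanSpace ℝ (Fin 3), W s y = W s 0 := by
  by_contra hnc
  push Not at hnc
  obtain ⟨s, hs, y, hy⟩ := typeBeta_exists_swirl_ne_zero hW hax hnc
  exact hy (tendsto_nhds_unique (swirl_innerLimit_tendsto hc hconv s hs y) (hthin s hs y))

/-- **THE Z1 CENSUS SENTENCE WITH THE SWIRL-CONCENTRATION RIDER (unconditional).** On K8's standing hypotheses verbatim
— `IsMaximalSmoothSolution 1 0 u p T⋆` (`T⋆ > 0`), `IsLerayHopfOn T⋆ 1 0 (u 0) u`, bounded on every closed sub-slab,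
axisymmetric slices, `|Γ(0, ·)| ≤ Mₛ` — there are gauge N-a zoom data (`tₖ ∈ [T⋆/2, T⋆)`, `λₖ > 0 → 0`,
`λₖ‖u‖ ≤ 1` on `[0, tₖ]`, centres `cₖ`) and a subsequence along which the zoom converges slice-wise locally uniformly to
a KNSS blow-up limit `W` with the Oseen identity, and EITHER
(α) `W ≡ c`, `‖c‖ = 1`, `c₁ = 0`; OR
(β) the centres lie ON THE AXIS (`cₖ = zₖe_z`), `W` is a counterexample to `AxisymmetricLiouvilleBoundedSwirl` with the
(I-5) signature, AND THE SWIRL CONCENTRATES AT THE VELOCITY SCALE: for some `s < 0`, `y`,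
`Γ(tₖ + λₖ²s, cₖ + λₖy) → Γ_W(s, y) ≠ 0` along the subsequence — at horizontal distance `λₖ‖y_h‖ = O(‖u‖_∞⁻¹)` from the
axis the physical swirl keeps a non-zero value, so the azimuthal velocity there is comparable to `‖u‖_∞`. [new here —
dictionary; unconditional] -/
theorem innerLimit_swirlConcentration_or_const_of_singularity (hT : 0 < T) (hmax : IsMaximalSmoothSolution 1 0 u p T)
    (hLH : IsLerayHopfOn T 1 0 (u 0) u) (hbdd : ∀ S < T, ∃ N : ℝ, 0 < N ∧ ∀ t ∈ Icc 0 S, ∀ x, ‖u t x‖ ≤ N)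
    (haxi : ∀ t, IsAxisymmetric (u t)) (hMₛ : ∀ x, |swirl (u 0) x| ≤ Mₛ) :
    ∃ (tn lamn : ℕ → ℝ) (cn : ℕ → EuclideanSpace ℝ (Fin 3)) (φ : ℕ → ℕ)
      (W : ℝ → EuclideanSpace ℝ (Fin 3) → EuclideanSpace ℝ (Fin 3)),
      (∀ k, T / 2 ≤ tn k ∧ tn k < T) ∧ (∀ k, 0 < lamn k) ∧ Tendsto lamn atTop (𝓝 0) ∧
      (∀ k, ∀ t ∈ Icc 0 (tn k), ∀ x, lamn k * ‖u t x‖ ≤ 1) ∧ StrictMono φ ∧ IsKNSSBlowupLimit W ∧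
      (∀ s < 0, TendstoLocallyUniformly
        (fun k => (lamn (φ k) • stPull (lamn (φ k) ^ 2) (lamn (φ k)) (tn (φ k)) (cn (φ k)) u) s) (W s) atTop) ∧
      (∀ s t : ℝ, s < t → t < 0 → ∀ x,
        W t x = Literature.Analysis.UnboundedOperators.heatExtension (W s) (t - s) x - oseenDuhamel 1 s W W t x) ∧
      ((∃ c : EuclideanSpace ℝ (Fin 3), ‖c‖ = 1 ∧ c 1 = 0 ∧ ∀ s < 0, ∀ y : EuclideanSpace ℝ (Fin 3), W s y = c) ∨
        ((∀ k, cn k 0 = 0 ∧ cn k 1 = 0) ∧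
          ¬ Summit.NavierStokesRegularity.NavierStokesRegularity.AxisymmetricLiouvilleBoundedSwirl ∧
          (∀ s < 0, IsAxisymmetric (W s)) ∧ (∀ s < 0, ∀ y : EuclideanSpace ℝ (Fin 3), |swirl (W s) y| ≤ Mₛ) ∧
          (∃ s < 0, ∃ x : EuclideanSpace ℝ (Fin 3), W s x ≠ W s 0) ∧
          (∃ s < 0, ∃ y : EuclideanSpace ℝ (Fin 3), swirl (W s) y ≠ 0 ∧
            Tendsto (fun k => swirl (u (tn (φ k) + lamn (φ k) ^ 2 * s)) (cn (φ k) + lamn (φ k) • y)) atTop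
              (𝓝 (swirl (W s) y))) ∧
          (∀ C : ℝ, ∃ s < 0, ∃ x : EuclideanSpace ℝ (Fin 3), C < cylRadius x * ‖poloidalPart (W s) x‖) ∧
          (∀ q : ℝ≥0∞, 1 ≤ q → q < ⊤ → ∀ K : ℝ≥0, ∃ s < 0, (K : ℝ≥0∞) < eLpNorm (swirl (W s)) q volume) ∧
          ∃ ε : ℝ, 0 < ε ∧ ∀ R : ℝ, ∃ s < 0, ∃ x : EuclideanSpace ℝ (Fin 3),
            R ≤ cylRadius x ∧ ε < |swirl (W s) x|)) := by
  have hT2 : 0 < T / 2 := by positivity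
  have hE := energyBound_of_lerayHopf hLH
  have hunb := unbounded_of_not_hasSmoothExtensionPast hT hmax.1 hLH hmax.2
  have hu := hmax.1
  obtain ⟨tn, lamn, rn, zn, htn, hlam, hlam0, hrn, hgauge, hnear⟩ :=
    exists_meridional_zoom_data_of_unbounded hT haxi hbdd hunb
  by_cases hbA : BddAbove (Set.range fun k => rn k / lamn k)
  · -- Case A along a subsequence: axis-centred zoom
    obtain ⟨C, hC⟩ := hbA
    obtain ⟨d, -, ψ, hψ, hd⟩ := tendsto_subseq_of_bounded (Metric.isBounded_Icc (0 : ℝ) C)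
      (x := fun k => rn k / lamn k) fun k => ⟨div_nonneg (hrn k) (hlam k).le, hC ⟨k, rfl⟩⟩
    obtain ⟨φ, W, hφ, hW, hconv, hax, hsw⟩ :=
      innerLimit_caseA_data_standing hT hu haxi hE hbdd hMₛ
        (tn := tn ∘ ψ) (lamn := lamn ∘ ψ) (rn := rn ∘ ψ) (zn := zn ∘ ψ) hT2 (fun k => htn (ψ k))
        (fun k => hlam (ψ k)) (hlam0.comp hψ.tendsto_atTop) (fun k => hgauge (ψ k))
        (hnear.comp hψ.tendsto_atTop) hd
    have hmild := zoom_limit_oseenIdentity hu hE hbdd (tn := tn ∘ ψ) (lamn := lamn ∘ ψ)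
      (xn := fun k => EuclideanSpace.single 2 (zn (ψ k))) hT2 (fun k => htn (ψ k)) (fun k => hlam (ψ k))
      (hlam0.comp hψ.tendsto_atTop) (fun k => hgauge (ψ k)) hφ hW.smooth.continuousOn hconv
    have hcax : ∀ k, (EuclideanSpace.single 2 (zn (ψ k)) : EuclideanSpace ℝ (Fin 3)) 0 = 0 ∧
        (EuclideanSpace.single 2 (zn (ψ k)) : EuclideanSpace ℝ (Fin 3)) 1 = 0 := fun k => by simp
    refine ⟨tn ∘ ψ, lamn ∘ ψ, fun k => EuclideanSpace.single 2 (zn (ψ k)), φ, W, fun k => htn (ψ k),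
      fun k => hlam (ψ k), hlam0.comp hψ.tendsto_atTop, fun k => hgauge (ψ k), hφ, hW, hconv, hmild, ?_⟩
    by_cases hnc : ∃ s < 0, ∃ x : EuclideanSpace ℝ (Fin 3), W s x ≠ W s 0
    · have hsw' : ∃ C : ℝ, ∀ s < 0, ∀ x, |swirl (W s) x| ≤ C := ⟨Mₛ, hsw⟩
      obtain ⟨s, hs, y, hy⟩ := typeBeta_exists_swirl_ne_zero hW hax hnc
      exact Or.inr ⟨hcax, not_axisymmetricLiouville_of_innerLimit_typeBeta hW hax hsw' hnc, hax, hsw, hnc,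
        ⟨s, hs, y, hy, swirl_innerLimit_tendsto hcax hconv s hs y⟩, knssBlowupLimit_VCR_poloidal hW hax hsw',
        fun q hq1 hq K => typeBeta_eLpNorm_swirl_unbounded hW hax hnc hq1 hq K,
        typeBeta_swirl_not_decay hW hax hnc⟩
    · push Not at hnc
      obtain ⟨β, hβ, hWβ⟩ := innerLimit_axialUnitStream_of_const hW hmild hax hnc
      refine Or.inl ⟨β • eZ, ?_, by simp [eZ], hWβ⟩
      rw [norm_smul, Real.norm_eq_abs, hβ]
      simp [eZ]
  · -- Case B along a subsequence: (α)
    obtain ⟨ψ, hψ, hd⟩ := exists_subseq_tendsto_atTop_of_not_bddAbove hbA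
    obtain ⟨φ, W, hφ, hW, hconv, hconst⟩ :=
      innerLimit_const_caseB_standing hu haxi hE hbdd (tn := tn ∘ ψ) (lamn := lamn ∘ ψ) (rn := rn ∘ ψ)
        (zn := zn ∘ ψ) hT2 (fun k => htn (ψ k)) (fun k => hlam (ψ k)) (hlam0.comp hψ.tendsto_atTop)
        (fun k => hgauge (ψ k)) (hnear.comp hψ.tendsto_atTop) hd
    have hmild := zoom_limit_oseenIdentity hu hE hbdd (tn := tn ∘ ψ) (lamn := lamn ∘ ψ)
      (xn := fun k => EuclideanSpace.single 0 (rn (ψ k)) + EuclideanSpace.single 2 (zn (ψ k))) hT2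
      (fun k => htn (ψ k)) (fun k => hlam (ψ k)) (hlam0.comp hψ.tendsto_atTop) (fun k => hgauge (ψ k)) hφ
      hW.smooth.continuousOn hconv
    have h1 := caseB_limit_apply_one_eq_zero hT hu haxi hbdd hMₛ (tn := tn ∘ ψ) (lamn := lamn ∘ ψ)
      (rn := rn ∘ ψ) (zn := zn ∘ ψ) hT2 (fun k => htn (ψ k)) (fun k => hlam (ψ k))
      (hlam0.comp hψ.tendsto_atTop) (hnear.comp hψ.tendsto_atTop) hd hφ hconv
    obtain ⟨c, hc1, hc⟩ := innerLimit_unitStream_of_const hW hmild hconst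
    refine ⟨tn ∘ ψ, lamn ∘ ψ, fun k => EuclideanSpace.single 0 (rn (ψ k)) + EuclideanSpace.single 2 (zn (ψ k)), φ, W,
      fun k => htn (ψ k), fun k => hlam (ψ k), hlam0.comp hψ.tendsto_atTop, fun k => hgauge (ψ k), hφ, hW, hconv,
      hmild, Or.inl ⟨c, hc1, ?_, hc⟩⟩
    rw [← hc (-1) (by norm_num) 0]
    exact h1 (-1) (by norm_num)

end SwirlConcentration

end TypeIIModulationDictionary
end Summit.NavierStokesRegularity.OSWSelfSimilar
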